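/-
Copyright (c) 2026 the pub-hodgecm-mathlib formalisation cell (harness21).  Prover seat hodgecm-mathlib-K2Liu-p14 (g2): Track B «K2-LIT»,
hLiu418 = stmt-HodgeConjecture-24832; LEAD F0P6-plan (g13) RULING M-157b (β4) + 09:48:19Z (3) «(β4-iii) assembly by value into ★ junction's `hb`», file (β4-iii).
-/
import Summits.HodgeConjecture.HodgeConjecture.Theorems.K2LiuIdelicUnramifiedZetaProduct      -- ★ (β4-ii) the unramified idelic zeta product (`∃ c_S ≠ 0` package)
import Summits.HodgeConjecture.HodgeConjecture.Theorems.K2LiuPartialEulerInverseHolomorphy    -- ★ (β3) `ζ_L^S(2s+1)⁻¹` holomorphic + locally bounded on `{0 < re s}`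
import Literature.NumberTheory.Automorphic.MirabolicEisensteinSeries                          -- ★ `tateVectorIntegral`, `ratVec`, `tateVectorIntegral_units_smul_eq`
import Literature.NumberTheory.Automorphic.AdelicPiSchwartzBruhatFourier                      -- ★ `piArch`, `piFinite` (pure tensors `Φ∞ ⊗ Φf`, ★ `tensor_mem_piSchwartzBruhat`)
import Literature.NumberTheory.Automorphic.SiegelSetVolume                                    -- ★ `exists_borel_mul_standardMaximalCompactGL` (Iwasawa `GL_n(𝔸) = B·K`)
import Literature.NumberTheory.Automorphic.RatPointsCoveringWeights                           -- ★ `ideleNorm_det_eq_one_of_isCompact`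
import Literature.NumberTheory.Automorphic.AdelicVectorHeightCompact                          -- ★ `sndHom_mem_of_mem_standardMaximalCompactGL`
import Literature.NumberTheory.Automorphic.IdeleGroupBorel                                    -- ★ `borelSpace_ideleGroup`
import HarnessLib

/-!
# Crux `HLiu418`, road `K2_Liu`, Road Φ organ G5 (β) «Godement sections exhaust the flat sections», file (β4-iii):
# GLOBAL ASSEMBLY — a flat `K`-finite section of `Ind_B^{GL₂(𝔸_L)}(|·|^{s+½}, |·|^{−(s+½)})` IS a finite combination, with coefficients
# holomorphic and locally bounded on `{0 < re s}`, of the Godement sections `|det g|^{s+½} ∫_{𝕀_L} Φ(a e₂ g)|a|^{2s+1} dν(a)` of pure tensors `Φ = Φ_∞ ⊗ Φ_f`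

Cell `hodgecm-mathlib`, crux item hLiu418 = `stmt-HodgeConjecture-24832`; prover K2Liu-p14 (g2).  THEOREMS ONLY (no `def`, no instance, no notation,
no named-fact hypothesis, no `sorry`); lane `--supports stmt-HodgeConjecture-24832` (count-neutral helper).  GENERIC number field `L`.
THE OUTPUT IS LITERALLY THE `hb` BINDER OF ★ (γ)'s junction `K2LiuMiddleCellGodementJunction.middle_eq_sum_mirabolicEisenstein` (with `e₀ = Pi.single 1 1`,
i.e. `ratVec L e₀ ᵥ* g = e₂ g` the bottom row) together with the two `hκ` inputs of its `had_of_face` ∕ `hag_of_face`.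
THE INPUTS ARE BY VALUE (RULING M-157b (β0)–(β5), LEAD 08:59:05Z «the (β0) face bytes are the consumer's»): for a finite family `b i : ℂ → GL₂(𝔸_L) → ℂ`,
* (T)(N) the SECTION LAW of `Ind(|·|^{s+½}, |·|^{−(s+½)})` under the diagonal torus (`hT`, ★ `glDiagonal`) and the unipotent radical (`hN`);
* (K) the VALUES ON `K = K_∞·GL₂(𝒪̂_L)` through the archimedean Godement integrals of finitely many Schwartz data `Φ∞ i j` with inverse coefficients
  `(A i j (2s+1))⁻¹` holomorphic on `{1 < re}` (`hK`, `hgi`, `hAinv`) — the (β0)∕(β5) faces (★ `K2LiuGL2GodementSectionOfFlatArch`, polynomial × Gaussian,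
  `A = (2π)^{1−w−a}Γ(w+a)`, CM-arch instantiation = file (β4-iv));
* (F) the FINITE SHELL IDENTITY `Φf i j (a_f · e₂ k_f) = 𝟙_D(a) · βf i j (k_f)` on `GL₂(𝒪̂_L)` — VERBATIM the conclusion of ★ (β4-i)
  `K2LiuGL2GodementFiniteAdelicShell.exists_finiteAdelic_schwartzBruhat_of_flat`, `D = {|a_v|_v = 1 (v ∈ S), |a_v|_v ≤ 1 (v ∉ S)}`.
THE MECHANISM.  §1 `B = T·N` in `GL₂` over any commutative ring.  §2 the Godement section `g ↦ |det g|^σ Z(Φ; σ; e₂ g)` obeys the law (T)(N)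
(`e₂ (D u g) = d₁ • e₂ g`, `det (D u g) = d₀ d₁ det g`, ★ `tateVectorIntegral_units_smul_eq`).  §3 ON `K` a pure tensor unfolds through (F):
`Z(Φ∞ ⊗ Φf; σ; e₂ k) = βf(k_f) · ∫_𝕀 Φ∞(a_∞ e₂ k_∞) 𝟙_D(a)|a|^{2σ} dν`, which ★ (β4-ii) evaluates as `c_S · (∫_{K_∞ˣ} Φ∞(x e₂ k_∞) N(x)^{2σ} dμ_∞) · (∏_{v∈S} μ_v 𝒪_vˣ) · ζ_L^S(2σ)`.
§4 with `|det k|_𝔸 = 1` and (K) this is the identity ON `K`, `κ i j s = (A i j (2s+1))⁻¹ · (c_S ∏_{v∈S} μ_v 𝒪_vˣ · ζ_L^S(2s+1))⁻¹`; Iwasawa (★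
`exists_borel_mul_standardMaximalCompactGL`) and the shared law extend it to `GL₂(𝔸_L)`; `κ` is holomorphic and locally bounded on `{0 < re s}` by ★ (β3) and `hAinv`
(constants carried by name, LEAD r1).  `Φ∞ i j ⊗ Φf i j ∈ piSchwartzBruhat L (Fin 2)` (also wanted by the junction) is ★ `tensor_mem_piSchwartzBruhat`.
HONEST LABEL.  `HC_CM` is proved only modulo the 7 printed citations (2 remaining named inputs: hLiu418 = `stmt-HodgeConjecture-24832`,
h413 = `stmt-HodgeConjecture-24833`) until rung 0 closes.

## References
* [JacquetLanglands1970] H. Jacquet, R. P. Langlands, *Automorphic forms on GL(2)*, LNM 114 (1970), §3 (the sections `f_Φ`), §11 pp. 171–172.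
* [Bump1997] D. Bump, *Automorphic Forms and Representations* (1997), §3.7 (Godement sections `f_Φ(g) = |det g|^s ∫ Φ((0,t)g)|t|^{2s} d^×t`).
* [CogdellAnalyticTheory2004] J. W. Cogdell, *Analytic theory of L-functions for GL_n*, §2.3 (`F(g, Φ; s) = |det g|^s ∫ Φ(a e_n g)|a|^{ns} d^×a`).
* [MoeglinWaldspurger1995] C. Mœglin, J.-L. Waldspurger, *Spectral decomposition and Eisenstein series* (1995), II.1.7, IV.1.9.
* [CasselsFrohlichANT1967] J. W. S. Cassels, A. Fröhlich (eds.), *Algebraic Number Theory* (1967), Ch. XV (Tate) Thm. 4.4.1.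
-/

set_option autoImplicit false
set_option linter.dupNamespace false -- the mandated namespace repeats `HodgeConjecture.HodgeConjecture`

noncomputable section

open MeasureTheory Measure NumberField NumberField.mixedEmbedding IsDedekindDomain Set Filter Topology
open scoped NNReal ENNReal Matrix Classical
open Literature.NumberTheory
open Literature.NumberTheory.GaloisRepresentations (ideleGroup)
open Literature.NumberTheory.Automorphic
open Summit.HodgeConjecture.HodgeConjecture.Cruxes.H413.F0P2wPartialDedekindZetaPole (hasProd_partialDedekindZeta)
open Summit.HodgeConjecture.HodgeConjecture.Cruxes.HLiu418.K2LiuPartialEulerInverseHolomorphy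

namespace Summit.HodgeConjecture.HodgeConjecture.Cruxes.HLiu418.K2LiuGL2GodementSectionsExhaustGlobal

/-! ## §1 `B = T·N` in `GL₂` over a commutative ring -/

section Borel

variable {R : Type*} [CommRing R]

/-- an upper triangular element of `GL₂(R)` has `(1,0)` entry `0` (`standardParabolicGL R id` is «block upper triangular for `id`»). [folklore] -/
theorem apply_one_zero_eq_zero_of_mem_standardParabolicGL {p : GL (Fin 2) R} (hp : p ∈ standardParabolicGL R (id : Fin 2 → Fin 2)) :
    (p : Matrix (Fin 2) (Fin 2) R) 1 0 = 0 :=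
  hp (show (id 0 : Fin 2) < id 1 by decide)

/-- **`B = T·N`**: an upper triangular `p ∈ GL₂(R)` is `diag(d₀, d₁) · u` with `d₀ = p₀₀`, `d₁ = p₁₁` UNITS (their inverses are the diagonal entries of the
upper triangular `p⁻¹`) and `u` unipotent upper triangular (`u₁₀ = 0`, `u₀₀ = u₁₁ = 1`). [cite: Bump1997, §3.7] -/
theorem exists_glDiagonal_mul_of_mem_standardParabolicGL {p : GL (Fin 2) R} (hp : p ∈ standardParabolicGL R (id : Fin 2 → Fin 2)) :
    ∃ (d : Fin 2 → Rˣ) (u : GL (Fin 2) R), (u : Matrix (Fin 2) (Fin 2) R) 1 0 = 0 ∧ (u : Matrix (Fin 2) (Fin 2) R) 0 0 = 1 ∧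
      (u : Matrix (Fin 2) (Fin 2) R) 1 1 = 1 ∧ ((d 0 : Rˣ) : R) = (p : Matrix (Fin 2) (Fin 2) R) 0 0 ∧ ((d 1 : Rˣ) : R) = (p : Matrix (Fin 2) (Fin 2) R) 1 1 ∧
      p = glDiagonal 2 R d * u := by
  have hp10 : (p : Matrix (Fin 2) (Fin 2) R) 1 0 = 0 := apply_one_zero_eq_zero_of_mem_standardParabolicGL hp
  have hq10 : ((p⁻¹ : GL (Fin 2) R) : Matrix (Fin 2) (Fin 2) R) 1 0 = 0 := apply_one_zero_eq_zero_of_mem_standardParabolicGL (Subgroup.inv_mem _ hp)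
  have hpq : (p : Matrix (Fin 2) (Fin 2) R) * ((p⁻¹ : GL (Fin 2) R) : Matrix (Fin 2) (Fin 2) R) = 1 := by
    rw [← Units.val_mul, mul_inv_cancel, Units.val_one]
  have h00 : (p : Matrix (Fin 2) (Fin 2) R) 0 0 * ((p⁻¹ : GL (Fin 2) R) : Matrix (Fin 2) (Fin 2) R) 0 0 = 1 := by
    have h := congrFun (congrFun hpq 0) 0
    rw [Matrix.mul_apply, Fin.sum_univ_two, hq10, mul_zero, add_zero, Matrix.one_apply_eq] at h
    exact h
  have h11 : (p : Matrix (Fin 2) (Fin 2) R) 1 1 * ((p⁻¹ : GL (Fin 2) R) : Matrix (Fin 2) (Fin 2) R) 1 1 = 1 := by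
    have h := congrFun (congrFun hpq 1) 1
    rw [Matrix.mul_apply, Fin.sum_univ_two, hp10, zero_mul, zero_add, Matrix.one_apply_eq] at h
    exact h
  set d : Fin 2 → Rˣ := ![⟨_, _, h00, by rw [mul_comm]; exact h00⟩, ⟨_, _, h11, by rw [mul_comm]; exact h11⟩] with hd
  have hd0 : ((d 0 : Rˣ) : R) = (p : Matrix (Fin 2) (Fin 2) R) 0 0 := rfl
  have hd1 : ((d 1 : Rˣ) : R) = (p : Matrix (Fin 2) (Fin 2) R) 1 1 := rfl
  have hdi0 : (((d 0)⁻¹ : Rˣ) : R) = ((p⁻¹ : GL (Fin 2) R) : Matrix (Fin 2) (Fin 2) R) 0 0 := rfl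
  have hdi1 : (((d 1)⁻¹ : Rˣ) : R) = ((p⁻¹ : GL (Fin 2) R) : Matrix (Fin 2) (Fin 2) R) 1 1 := rfl
  refine ⟨d, (glDiagonal 2 R d)⁻¹ * p, ?_, ?_, ?_, hd0, hd1, (mul_inv_cancel_left _ _).symm⟩
  all_goals
    rw [Units.val_mul, ← map_inv, coe_glDiagonal, Matrix.diagonal_mul, Pi.inv_apply]
  · rw [hp10, mul_zero]
  · rw [hdi0, mul_comm]; exact h00
  · rw [hdi1, mul_comm]; exact h11

/-- the determinant of `diag(d)` is `d₀ d₁` (as units). [folklore] -/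
theorem det_glDiagonal_two (d : Fin 2 → Rˣ) : Matrix.GeneralLinearGroup.det (glDiagonal 2 R d) = d 0 * d 1 := by
  ext
  rw [Matrix.GeneralLinearGroup.val_det_apply, coe_glDiagonal, Matrix.det_diagonal, Fin.prod_univ_two, Units.val_mul]

/-- a unipotent upper triangular `u` has `det u = 1` (as units). [folklore] -/
theorem det_eq_one_of_unipotent {u : GL (Fin 2) R} (hu10 : (u : Matrix (Fin 2) (Fin 2) R) 1 0 = 0) (hu00 : (u : Matrix (Fin 2) (Fin 2) R) 0 0 = 1)
    (hu11 : (u : Matrix (Fin 2) (Fin 2) R) 1 1 = 1) : Matrix.GeneralLinearGroup.det u = 1 := by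
  ext
  rw [Matrix.GeneralLinearGroup.val_det_apply, Matrix.det_fin_two, hu10, hu00, hu11, Units.val_one]
  ring

/-- the bottom row of `diag(d) · u · g` is `d₁ •` the bottom row of `g` (`u` unipotent upper triangular). [cite: Bump1997, §3.7] -/
theorem glDiagonal_mul_mul_apply_one (d : Fin 2 → Rˣ) {u : GL (Fin 2) R} (hu10 : (u : Matrix (Fin 2) (Fin 2) R) 1 0 = 0)
    (hu11 : (u : Matrix (Fin 2) (Fin 2) R) 1 1 = 1) (g : GL (Fin 2) R) :
    ((glDiagonal 2 R d * u * g : GL (Fin 2) R) : Matrix (Fin 2) (Fin 2) R) 1 = ((d 1 : Rˣ) : R) • (g : Matrix (Fin 2) (Fin 2) R) 1 := by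
  have hrow : ((glDiagonal 2 R d * u : GL (Fin 2) R) : Matrix (Fin 2) (Fin 2) R) 1 = ((d 1 : Rˣ) : R) • (Pi.single 1 1 : Fin 2 → R) := by
    funext j
    rw [Units.val_mul, coe_glDiagonal, Matrix.diagonal_mul, Pi.smul_apply, smul_eq_mul]
    fin_cases j
    · simp [hu10]
    · simp [hu11]
  funext j
  rw [Units.val_mul, Matrix.mul_apply, Pi.smul_apply, smul_eq_mul]
  simp_rw [show ∀ l, ((glDiagonal 2 R d * u : GL (Fin 2) R) : Matrix (Fin 2) (Fin 2) R) 1 l = (((d 1 : Rˣ) : R) • (Pi.single 1 1 : Fin 2 → R)) l from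
    fun l => congrFun hrow l]
  rw [Fin.sum_univ_two]
  simp

end Borel


/-! ## §2 The section law of the global Godement section `g ↦ |det g|^σ · Z(Φ; σ; e₂ g)` -/

section GodementLaw

variable {L : Type} [Field L] [NumberField L]

/-- `ratVec L e₂ = e₂` in `𝔸_L²`. [folklore] -/
theorem ratVec_single_one : ratVec L (Pi.single 1 1 : Fin 2 → L) = (Pi.single 1 1 : Fin 2 → AdeleRing (𝓞 L) L) := by
  funext i
  simp [ratVec, Pi.single_apply]

/-- **`e₂ g = g 1`**: the mirabolic vector `ratVec L e₂ ᵥ* g` of ★ `mirabolicEisenstein` at `e₀ = e₂` is the bottom row of `g`. [cite: CogdellAnalyticTheory2004, §2.3] -/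
theorem ratVec_single_one_vecMul (M : Matrix (Fin 2) (Fin 2) (AdeleRing (𝓞 L) L)) :
    ratVec L (Pi.single 1 1 : Fin 2 → L) ᵥ* M = M 1 := by
  rw [ratVec_single_one, Matrix.single_one_vecMul]
  rfl

variable [MeasurableSpace (AdeleRing (𝓞 L) L)] [BorelSpace (AdeleRing (𝓞 L) L)] (ν : Measure (ideleGroup L)) [ν.IsMulRightInvariant]

/-- **THE SECTION LAW OF THE GODEMENT SECTION** (`B = T·N`, `T` acting by `|d₀|^σ |d₁|^{−σ}`, `N` trivially): for `d : Fin 2 → 𝕀_L`, `u` unipotent upper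
triangular and any `g`,  `|det(D u g)|^σ · Z(Φ; σ; e₂(D u g)) = |d₀|^σ |d₁|^{−σ} · (|det g|^σ · Z(Φ; σ; e₂ g))`  (`e₂ (D u g) = d₁ • e₂ g` and
`Z(Φ; σ; d₁ • x) = |d₁|^{−2σ} Z(Φ; σ; x)`, ★ `tateVectorIntegral_units_smul_eq`; `det(D u g) = d₀ d₁ det g`).  I.e. the Godement section lies in
`Ind_B^{GL₂(𝔸_L)}(|·|^σ, |·|^{−σ})`. [cite: Bump1997, §3.7] [cite: CogdellAnalyticTheory2004, §2.3] [cite: JacquetLanglands1970, §3] -/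
theorem godementSection_glDiagonal_mul_mul (Φ : (Fin 2 → AdeleRing (𝓞 L) L) → ℂ) (σ : ℂ) (d : Fin 2 → (AdeleRing (𝓞 L) L)ˣ)
    {u : GL (Fin 2) (AdeleRing (𝓞 L) L)} (hu10 : (u : Matrix (Fin 2) (Fin 2) (AdeleRing (𝓞 L) L)) 1 0 = 0)
    (hu00 : (u : Matrix (Fin 2) (Fin 2) (AdeleRing (𝓞 L) L)) 0 0 = 1) (hu11 : (u : Matrix (Fin 2) (Fin 2) (AdeleRing (𝓞 L) L)) 1 1 = 1)
    (g : GL (Fin 2) (AdeleRing (𝓞 L) L)) :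
    ((IdeleClassGroup.ideleNorm L (Matrix.GeneralLinearGroup.det (glDiagonal 2 (AdeleRing (𝓞 L) L) d * u * g)) : ℝ) : ℂ) ^ σ *
        tateVectorIntegral L ν Φ σ (ratVec L (Pi.single 1 1) ᵥ*
          ((glDiagonal 2 (AdeleRing (𝓞 L) L) d * u * g : GL (Fin 2) (AdeleRing (𝓞 L) L)) : Matrix (Fin 2) (Fin 2) (AdeleRing (𝓞 L) L))) =
      ((IdeleClassGroup.ideleNorm L (d 0) : ℝ) : ℂ) ^ σ * ((IdeleClassGroup.ideleNorm L (d 1) : ℝ) : ℂ) ^ (-σ) *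
        (((IdeleClassGroup.ideleNorm L (Matrix.GeneralLinearGroup.det g) : ℝ) : ℂ) ^ σ *
          tateVectorIntegral L ν Φ σ (ratVec L (Pi.single 1 1) ᵥ* (g : Matrix (Fin 2) (Fin 2) (AdeleRing (𝓞 L) L)))) := by
  rw [ratVec_single_one_vecMul, ratVec_single_one_vecMul, glDiagonal_mul_mul_apply_one d hu10 hu11 g,
    show ((d 1 : (AdeleRing (𝓞 L) L)ˣ) : AdeleRing (𝓞 L) L) • (g : Matrix (Fin 2) (Fin 2) (AdeleRing (𝓞 L) L)) 1 =
      ((d 1 : ideleGroup L) : AdeleRing (𝓞 L) L) • (g : Matrix (Fin 2) (Fin 2) (AdeleRing (𝓞 L) L)) 1 from rfl,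
    tateVectorIntegral_units_smul_eq ν Φ σ _ (d 1), map_mul Matrix.GeneralLinearGroup.det, map_mul Matrix.GeneralLinearGroup.det,
    det_glDiagonal_two, det_eq_one_of_unipotent hu10 hu00 hu11, mul_one, map_mul (IdeleClassGroup.ideleNorm L),
    map_mul (IdeleClassGroup.ideleNorm L), NNReal.coe_mul, NNReal.coe_mul, Complex.ofReal_mul,
    Complex.mul_cpow_ofReal_nonneg (by positivity) (NNReal.coe_nonneg _), Complex.ofReal_mul,
    Complex.mul_cpow_ofReal_nonneg (NNReal.coe_nonneg _) (NNReal.coe_nonneg _)]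
  have hx1 : ((IdeleClassGroup.ideleNorm L (d 1) : ℝ) : ℂ) ≠ 0 := by exact_mod_cast ideleNorm_ne_zero (d 1)
  have hpow : ((IdeleClassGroup.ideleNorm L (d 1) : ℝ) : ℂ) ^ σ * (((IdeleClassGroup.ideleNorm L (d 1) : ℝ) : ℂ) ^ (((2 : ℕ) : ℂ) * σ))⁻¹ =
      ((IdeleClassGroup.ideleNorm L (d 1) : ℝ) : ℂ) ^ (-σ) := by
    rw [← Complex.cpow_neg, ← Complex.cpow_add _ _ hx1]
    congr 1
    push_cast
    ring
  calc _ = ((IdeleClassGroup.ideleNorm L (d 0) : ℝ) : ℂ) ^ σ *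
        (((IdeleClassGroup.ideleNorm L (d 1) : ℝ) : ℂ) ^ σ * (((IdeleClassGroup.ideleNorm L (d 1) : ℝ) : ℂ) ^ (((2 : ℕ) : ℂ) * σ))⁻¹) *
        (((IdeleClassGroup.ideleNorm L (Matrix.GeneralLinearGroup.det g) : ℝ) : ℂ) ^ σ *
          tateVectorIntegral L ν Φ σ ((g : Matrix (Fin 2) (Fin 2) (AdeleRing (𝓞 L) L)) 1)) := by ring
    _ = _ := by rw [hpow]

end GodementLaw

/-! ## §3 ON `K`: the Tate vector integral of a pure tensor `Φ∞ ⊗ Φf` whose finite part satisfies the shell identity (F) -/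

section OnK

variable {L : Type} [Field L] [NumberField L]

/-- **archimedean coordinates of `a • e₂ k`**: `(a • e₂ k)_∞ = a_∞ · e₂ (k_∞)` with `a_∞ = archUnitsOfIdele L a`, `k_∞ = GLn.toMixed 2 L k`
(★ `piArch_apply`, ★ `coe_archUnitsOfIdele`; both are `InfiniteAdeleRing.ringEquiv_mixedSpace` read entrywise). [folklore] -/
theorem piArch_smul_apply_one (a : ideleGroup L) (k : GL (Fin 2) (AdeleRing (𝓞 L) L)) :
    piArch L (Fin 2) (((a : ideleGroup L) : AdeleRing (𝓞 L) L) • (k : Matrix (Fin 2) (Fin 2) (AdeleRing (𝓞 L) L)) 1) =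
      fun j => ((archUnitsOfIdele L a : (mixedSpace L)ˣ) : mixedSpace L) *
        ((GLn.toMixed 2 L k : GL (Fin 2) (mixedSpace L)) : Matrix (Fin 2) (Fin 2) (mixedSpace L)) 1 j := by
  funext j
  rw [piArch_apply, coe_archUnitsOfIdele]
  change InfiniteAdeleRing.ringEquiv_mixedSpace L ((((a : ideleGroup L) : AdeleRing (𝓞 L) L)).1 *
    ((k : Matrix (Fin 2) (Fin 2) (AdeleRing (𝓞 L) L)) 1 j).1) = _
  rw [map_mul]
  rfl

/-- **finite coordinates of `a • e₂ k`**: `(a • e₂ k)_f = a_f · e₂ (k_f)` with `k_f = GLn.sndHom 2 L k`. [folklore] -/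
theorem piFinite_smul_apply_one (a : ideleGroup L) (k : GL (Fin 2) (AdeleRing (𝓞 L) L)) :
    piFinite L (Fin 2) (((a : ideleGroup L) : AdeleRing (𝓞 L) L) • (k : Matrix (Fin 2) (Fin 2) (AdeleRing (𝓞 L) L)) 1) =
      fun j => ((a : ideleGroup L) : AdeleRing (𝓞 L) L).2 *
        ((GLn.sndHom 2 L k : GL (Fin 2) (FiniteAdeleRing (𝓞 L) L)) : Matrix (Fin 2) (Fin 2) (FiniteAdeleRing (𝓞 L) L)) 1 j := by
  funext j
  rfl

variable [MeasurableSpace (AdeleRing (𝓞 L) L)] (ν : Measure (ideleGroup L))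

/-- **ON `K`, THE PURE TENSOR UNFOLDS**: if `Φf(a_f · e₂ k_f) = 𝟙_D(a) · βf(k_f)` for `k_f ∈ GL₂(𝒪̂_L)` (the shell identity (F) of ★ (β4-i)), then for
`k ∈ K = K_∞·GL₂(𝒪̂_L)` and `2σ = w`:  `Z(Φ∞ ⊗ Φf; σ; e₂ k) = βf(k_f) · ∫_{𝕀_L} Φ∞(a_∞ · e₂ k_∞) 𝟙_D(a) |a|^w dν(a)` — the idelic integral of ★ (β4-ii)
with `g(x) = Φ∞(x · e₂ k_∞)`. [cite: JacquetLanglands1970, §11 p. 171] [cite: CogdellAnalyticTheory2004, §2.3] -/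
theorem tateVectorIntegral_tensor_eq (Φinf : (Fin 2 → mixedSpace L) → ℂ) (Φfin : (Fin 2 → FiniteAdeleRing (𝓞 L) L) → ℂ)
    (S : Finset (HeightOneSpectrum (𝓞 L))) (βf : GL (Fin 2) (FiniteAdeleRing (𝓞 L) L) → ℂ)
    (hfin : ∀ (a : ideleGroup L) (kf : GL (Fin 2) (FiniteAdeleRing (𝓞 L) L)), kf ∈ glFiniteIntegralLevel 2 L →
      Φfin (fun l => ((a : ideleGroup L) : AdeleRing (𝓞 L) L).2 * (kf : Matrix (Fin 2) (Fin 2) (FiniteAdeleRing (𝓞 L) L)) 1 l) =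
        {a : ideleGroup L | (∀ v ∈ S, Valued.v (((a : ideleGroup L) : AdeleRing (𝓞 L) L).2 v) = 1) ∧
            ∀ v, v ∉ S → Valued.v (((a : ideleGroup L) : AdeleRing (𝓞 L) L).2 v) ≤ 1}.indicator (fun _ => (1 : ℂ)) a * βf kf)
    (σ w : ℂ) (hw : 2 * σ = w) {k : GL (Fin 2) (AdeleRing (𝓞 L) L)} (hk : k ∈ standardMaximalCompactGL 2 L) :
    tateVectorIntegral L ν (fun v => Φinf (piArch L (Fin 2) v) * Φfin (piFinite L (Fin 2) v)) σ
        (ratVec L (Pi.single 1 1) ᵥ* (k : Matrix (Fin 2) (Fin 2) (AdeleRing (𝓞 L) L))) =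
      βf (GLn.sndHom 2 L k) *
        ∫ a, (fun x : (mixedSpace L)ˣ => Φinf (fun l => (x : mixedSpace L) *
              ((GLn.toMixed 2 L k : GL (Fin 2) (mixedSpace L)) : Matrix (Fin 2) (Fin 2) (mixedSpace L)) 1 l)) (archUnitsOfIdele L a) *
            {a : ideleGroup L | (∀ v ∈ S, Valued.v (((a : ideleGroup L) : AdeleRing (𝓞 L) L).2 v) = 1) ∧
              ∀ v, v ∉ S → Valued.v (((a : ideleGroup L) : AdeleRing (𝓞 L) L).2 v) ≤ 1}.indicator (fun _ => (1 : ℂ)) a *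
            ((IdeleClassGroup.ideleNorm L a : ℝ) : ℂ) ^ w ∂ν := by
  rw [tateVectorIntegral, ← integral_const_mul]
  refine integral_congr_ae (Eventually.of_forall fun a => ?_)
  simp only [eisensteinKernel]
  rw [ratVec_single_one_vecMul, piArch_smul_apply_one, piFinite_smul_apply_one,
    hfin a _ (sndHom_mem_of_mem_standardMaximalCompactGL hk), ← hw]
  push_cast
  ring

end OnK

/-! ## §4 MAIN: Godement sections exhaust the flat `K`-finite sections (global assembly, the `hb` binder of ★ (γ)'s junction) -/

section Main

variable {L : Type} [Field L] [NumberField L]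
variable [MeasurableSpace (AdeleRing (𝓞 L) L)] [BorelSpace (AdeleRing (𝓞 L) L)]
  [MeasurableSpace (mixedSpace L)ˣ] [BorelSpace (mixedSpace L)ˣ]

/-- a function holomorphic on the open half-plane `{1 < re}` is bounded near `z` along `s ↦ 2s + 1`, for `0 < re z`: there are `C ≥ 0`, `r > 0` with
`‖f (2s+1)‖ ≤ C` for `dist s z < r` (continuity at an interior point). [folklore] -/
theorem exists_bound_comp_two_mul_add_one {f : ℂ → ℂ} (hf : DifferentiableOn ℂ f {w : ℂ | 1 < w.re}) {z : ℂ} (hz : 0 < z.re) :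
    ∃ C r : ℝ, 0 ≤ C ∧ 0 < r ∧ ∀ s : ℂ, dist s z < r → ‖f (2 * s + 1)‖ ≤ C := by
  have hcomp : DifferentiableOn ℂ (fun s : ℂ => f (2 * s + 1)) {s : ℂ | 0 < s.re} :=
    hf.comp (((differentiableOn_const _).mul differentiableOn_id).add (differentiableOn_const _)) fun s hs => by
      show 1 < (2 * s + 1).re
      rw [re_two_mul_add_one]
      have : 0 < s.re := hs
      linarith
  have hcont : ContinuousAt (fun s : ℂ => f (2 * s + 1)) z :=
    (hcomp.differentiableAt ((isOpen_lt continuous_const Complex.continuous_re).mem_nhds hz)).continuousAt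
  obtain ⟨r, hr, hball⟩ := Metric.continuousAt_iff.1 hcont 1 one_pos
  refine ⟨‖f (2 * z + 1)‖ + 1, r, by positivity, hr, fun s hs => ?_⟩
  have h := (hball hs).le
  rw [dist_eq_norm] at h
  calc ‖f (2 * s + 1)‖ = ‖f (2 * z + 1) + (f (2 * s + 1) - f (2 * z + 1))‖ := by rw [add_sub_cancel]
    _ ≤ ‖f (2 * z + 1)‖ + ‖f (2 * s + 1) - f (2 * z + 1)‖ := norm_add_le _ _
    _ ≤ ‖f (2 * z + 1)‖ + 1 := by linarith

/-- the cancellation behind the identity on `K`: `χ · (A⁻¹ I β) = [A⁻¹ (cM)⁻¹ ζ⁻¹] · χ · β · (c I M ζ)` for `c M ≠ 0`, `ζ ≠ 0`. [folklore] -/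
theorem cancel_aux {A I β χ c M ζ : ℂ} (hcM : c * M ≠ 0) (hζ : ζ ≠ 0) :
    χ * (A⁻¹ * I * β) = A⁻¹ * ((c * M)⁻¹ * ζ⁻¹) * (χ * (β * (c * I * M * ζ))) := by
  calc χ * (A⁻¹ * I * β) = χ * (A⁻¹ * I * β) * ((c * M)⁻¹ * (c * M)) * (ζ⁻¹ * ζ) := by
        rw [inv_mul_cancel₀ hcM, inv_mul_cancel₀ hζ, mul_one, mul_one]
    _ = _ := by ring

/-- **GODEMENT SECTIONS EXHAUST THE FLAT `K`-FINITE SECTIONS — GLOBAL ASSEMBLY** (RULING M-157b (β4); the `hb` binder of ★ (γ)'s junction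
`K2LiuMiddleCellGodementJunction.middle_eq_sum_mirabolicEisenstein` at `e₀ = Pi.single 1 1`, with the `hκ` inputs of its `had_of_face` ∕ `hag_of_face`).
DATA: Haar measures `ν` on `𝕀_L`, `μ_∞` on `K_∞ˣ`; a finite set `S` of finite places; finite families `b i : ℂ → GL₂(𝔸_L) → ℂ` of sections, archimedean Schwartz data
`Φ∞ i j`, finite-adelic data `Φf i j`, arch coefficients `A i j`, finite values `βf i j`.  HYPOTHESES BY VALUE:  (T) `hT` ∕ (N) `hN` — for `0 < re s`, `b i s` is a
section of `Ind_B^{GL₂(𝔸_L)}(|·|^{s+½}, |·|^{−(s+½)})` (`b i s (diag(d) g) = |d₀|^{s+½}|d₁|^{−(s+½)} b i s g`, `b i s (u g) = b i s g` for unipotent upper triangular `u`);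
(K) `hK` — ON `K = K_∞·GL₂(𝒪̂_L)`, `b i s k = Σ_j (A i j (2s+1))⁻¹ · (∫_{K_∞ˣ} Φ∞ i j (x · e₂ k_∞) N(x)^{2s+1} dμ_∞) · βf i j (k_f)`, the arch integrands
integrable for `1 < re w` (`hgi`), `w ↦ (A i j w)⁻¹` holomorphic on `{1 < re w}` (`hAinv`) — the (β0)∕(β5) faces (★ `K2LiuGL2GodementSectionOfFlatArch`);
(F) `hfin` — `Φf i j (a_f · e₂ k_f) = 𝟙_D(a) · βf i j (k_f)` on `GL₂(𝒪̂_L)`, VERBATIM ★ (β4-i) `K2LiuGL2GodementFiniteAdelicShell.exists_finiteAdelic_schwartzBruhat_of_flat`.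
CONCLUSION: there are `κ i j : ℂ → ℂ`, HOLOMORPHIC on `{0 < re s}` and BOUNDED near every `z` with `0 < re z` (uniformly in `i, j`), such that for `0 < re s` and ALL `g`
  `b i s g = Σ_j κ i j s · |det g|^{s+½} · Z(Φ∞ i j ⊗ Φf i j; s+½; e₂ g)`   (`Z =` ★ `tateVectorIntegral L ν`, `e₂ g = ratVec L (Pi.single 1 1) ᵥ* g`);
explicitly `κ i j s = (A i j (2s+1))⁻¹ · (c_S · ∏_{v∈S} μ_v(𝒪_vˣ) · ζ_L^S(2s+1))⁻¹` with the constants of ★ (β4-ii) (carried, never evaluated; the local Haar measures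
`μ_v` are chosen inside the proof) and ★ (β3) for `ζ_L^S(2s+1)⁻¹`.  [cite: JacquetLanglands1970, §3, §11 pp. 171–172] [cite: Bump1997, §3.7]
[cite: CogdellAnalyticTheory2004, §2.3] [cite: MoeglinWaldspurger1995, II.1.7, IV.1.9] [cite: CasselsFrohlichANT1967, Ch. XV Thm. 4.4.1] -/
theorem exists_godement_exhaust (ν : Measure (ideleGroup L)) [ν.IsHaarMeasure] (μinf : Measure (mixedSpace L)ˣ) [μinf.IsHaarMeasure]
    (S : Finset (HeightOneSpectrum (𝓞 L))) {I J : Type*} [Fintype I] [Fintype J]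
    (b : I → ℂ → GL (Fin 2) (AdeleRing (𝓞 L) L) → ℂ)
    (Φinf : I → J → SchwartzMap (Fin 2 → mixedSpace L) ℂ) (Φfin : I → J → (Fin 2 → FiniteAdeleRing (𝓞 L) L) → ℂ)
    (A : I → J → ℂ → ℂ) (βf : I → J → GL (Fin 2) (FiniteAdeleRing (𝓞 L) L) → ℂ)
    (hT : ∀ (i : I) (s : ℂ), 0 < s.re → ∀ (d : Fin 2 → (AdeleRing (𝓞 L) L)ˣ) (g : GL (Fin 2) (AdeleRing (𝓞 L) L)),
      b i s (glDiagonal 2 (AdeleRing (𝓞 L) L) d * g) =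
        ((IdeleClassGroup.ideleNorm L (d 0) : ℝ) : ℂ) ^ (s + 1 / 2) * ((IdeleClassGroup.ideleNorm L (d 1) : ℝ) : ℂ) ^ (-(s + 1 / 2)) * b i s g)
    (hN : ∀ (i : I) (s : ℂ), 0 < s.re → ∀ (u g : GL (Fin 2) (AdeleRing (𝓞 L) L)), (u : Matrix (Fin 2) (Fin 2) (AdeleRing (𝓞 L) L)) 1 0 = 0 →
      (u : Matrix (Fin 2) (Fin 2) (AdeleRing (𝓞 L) L)) 0 0 = 1 → (u : Matrix (Fin 2) (Fin 2) (AdeleRing (𝓞 L) L)) 1 1 = 1 → b i s (u * g) = b i s g)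
    (hK : ∀ (i : I) (s : ℂ), 0 < s.re → ∀ k ∈ standardMaximalCompactGL 2 L, b i s k = ∑ j, (A i j (2 * s + 1))⁻¹ *
      (∫ x : (mixedSpace L)ˣ, Φinf i j (fun l => (x : mixedSpace L) *
          ((GLn.toMixed 2 L k : GL (Fin 2) (mixedSpace L)) : Matrix (Fin 2) (Fin 2) (mixedSpace L)) 1 l) *
        ((mixedEmbedding.norm ((x : (mixedSpace L)ˣ) : mixedSpace L) : ℝ) : ℂ) ^ (2 * s + 1) ∂μinf) * βf i j (GLn.sndHom 2 L k))
    (hgi : ∀ (i : I) (j : J) (w : ℂ), 1 < w.re → ∀ k ∈ standardMaximalCompactGL 2 L,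
      Integrable (fun x : (mixedSpace L)ˣ => Φinf i j (fun l => (x : mixedSpace L) *
          ((GLn.toMixed 2 L k : GL (Fin 2) (mixedSpace L)) : Matrix (Fin 2) (Fin 2) (mixedSpace L)) 1 l) *
        ((mixedEmbedding.norm ((x : (mixedSpace L)ˣ) : mixedSpace L) : ℝ) : ℂ) ^ w) μinf)
    (hAinv : ∀ (i : I) (j : J), DifferentiableOn ℂ (fun w : ℂ => (A i j w)⁻¹) {w : ℂ | 1 < w.re})
    (hfin : ∀ (i : I) (j : J) (a : ideleGroup L) (kf : GL (Fin 2) (FiniteAdeleRing (𝓞 L) L)), kf ∈ glFiniteIntegralLevel 2 L →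
      Φfin i j (fun l => ((a : ideleGroup L) : AdeleRing (𝓞 L) L).2 * (kf : Matrix (Fin 2) (Fin 2) (FiniteAdeleRing (𝓞 L) L)) 1 l) =
        {a : ideleGroup L | (∀ v ∈ S, Valued.v (((a : ideleGroup L) : AdeleRing (𝓞 L) L).2 v) = 1) ∧
            ∀ v, v ∉ S → Valued.v (((a : ideleGroup L) : AdeleRing (𝓞 L) L).2 v) ≤ 1}.indicator (fun _ => (1 : ℂ)) a * βf i j kf) :
    ∃ κ : I → J → ℂ → ℂ,
      (∀ i j, DifferentiableOn ℂ (κ i j) {s : ℂ | 0 < s.re}) ∧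
      (∀ z : ℂ, 0 < z.re → ∃ C r : ℝ, 0 ≤ C ∧ 0 < r ∧ ∀ s : ℂ, dist s z < r → ∀ i j, ‖κ i j s‖ ≤ C) ∧
      ∀ (i : I) (s : ℂ) (g : GL (Fin 2) (AdeleRing (𝓞 L) L)), 0 < s.re →
        b i s g = ∑ j, κ i j s *
          (((IdeleClassGroup.ideleNorm L (Matrix.GeneralLinearGroup.det g) : ℝ) : ℂ) ^ (s + 1 / 2) *
            tateVectorIntegral L ν (fun v => Φinf i j (piArch L (Fin 2) v) * Φfin i j (piFinite L (Fin 2) v)) (s + 1 / 2)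
              (ratVec L (Pi.single 1 1) ᵥ* (g : Matrix (Fin 2) (Fin 2) (AdeleRing (𝓞 L) L)))) := by
  haveI : BorelSpace (ideleGroup L) := borelSpace_ideleGroup L
  -- Borel structures and Haar measures at the finite places (they only enter the constant `M = ∏_{v∈S} μ_v(𝒪_vˣ)`)
  letI mL : ∀ v : HeightOneSpectrum (𝓞 L), MeasurableSpace (v.adicCompletion L) := fun v => borel _
  haveI : ∀ v : HeightOneSpectrum (𝓞 L), BorelSpace (v.adicCompletion L) := fun v => ⟨rfl⟩
  haveI : ∀ v : HeightOneSpectrum (𝓞 L), BorelSpace (v.adicCompletion L)ˣ := fun v => Units.borelSpace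
  set μv : ∀ v : HeightOneSpectrum (𝓞 L), Measure (v.adicCompletion L)ˣ := fun v => Measure.haar with hμv
  haveI hμvH : ∀ v, (μv v).IsHaarMeasure := fun v => by rw [hμv]; infer_instance
  -- ★ (β4-ii): the unramified idelic zeta product with its constant `c = c_S ≠ 0`
  obtain ⟨c, hc0, hmain⟩ := K2LiuIdelicUnramifiedZetaProduct.exists_integral_arch_mul_indicator_mul_ideleNorm_cpow_eq ν μinf μv S
  set M : ℂ := ∏ v ∈ S, (((μv v).real {y : (v.adicCompletion L)ˣ | Valued.v (y : v.adicCompletion L) = 1} : ℝ) : ℂ) with hM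
  have hcM0 : (c : ℂ) * M ≠ 0 := by
    refine mul_ne_zero (by exact_mod_cast hc0) (Finset.prod_ne_zero_iff.2 fun v _ => ?_)
    exact_mod_cast (measureReal_ne_zero_iff (measure_units_valued_eq_one_ne_top v (μv v))).2 (measure_units_valued_eq_one_ne_zero v (μv v))
  refine ⟨fun i j s => (A i j (2 * s + 1))⁻¹ * (((c : ℂ) * M)⁻¹ *
      (partialStandardL (↑S : Set (HeightOneSpectrum (𝓞 L))) (fun _ => ({1} : Multiset ℂ)) (2 * s + 1))⁻¹), ?_, ?_, ?_⟩
  · -- `had`: holomorphy on `{0 < re s}` (`hAinv` along `s ↦ 2s+1`, ★ (β3))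
    intro i j
    refine DifferentiableOn.mul ?_ ((differentiableOn_const _).mul differentiableOn_inv_partialDedekindZeta_two_mul_add_one)
    exact (hAinv i j).comp (((differentiableOn_const _).mul differentiableOn_id).add (differentiableOn_const _)) fun s hs => by
      show 1 < (2 * s + 1).re
      rw [re_two_mul_add_one]
      have : 0 < s.re := hs
      linarith
  · -- `hag`: local bounds, uniform over the finitely many `(i, j)`
    intro z hz
    obtain ⟨Cζ, rζ, hCζ, hrζ, hζb⟩ := exists_bound_inv_partialDedekindZeta_two_mul_add_one (S := (↑S : Set (HeightOneSpectrum (𝓞 L)))) hz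
    choose CA rA hCA hrA hAb using fun ij : I × J => exists_bound_comp_two_mul_add_one (hAinv ij.1 ij.2) hz
    have hev : ∀ᶠ s in 𝓝 z, ∀ ij : I × J, ‖(A ij.1 ij.2 (2 * s + 1))⁻¹‖ ≤ CA ij :=
      Filter.eventually_all.2 fun ij => Metric.eventually_nhds_iff.2 ⟨rA ij, hrA ij, fun s hs => hAb ij s hs⟩
    obtain ⟨r₁, hr₁, hb₁⟩ := Metric.eventually_nhds_iff.1 hev
    refine ⟨(∑ ij : I × J, CA ij) * (‖((c : ℂ) * M)⁻¹‖ * Cζ), min r₁ rζ,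
      mul_nonneg (Finset.sum_nonneg fun ij _ => hCA ij) (mul_nonneg (norm_nonneg _) hCζ), lt_min hr₁ hrζ, fun s hs i j => ?_⟩
    have h1 : ‖(A i j (2 * s + 1))⁻¹‖ ≤ ∑ ij : I × J, CA ij :=
      (hb₁ (lt_of_lt_of_le hs (min_le_left _ _)) (i, j)).trans
        (Finset.single_le_sum (f := fun ij : I × J => CA ij) (fun ij _ => hCA ij) (Finset.mem_univ (i, j)))
    have h2 := hζb s (lt_of_lt_of_le hs (min_le_right _ _))
    rw [norm_mul, norm_mul]
    gcongr
    exact Finset.sum_nonneg fun ij _ => hCA ij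
  · -- the identity: Iwasawa `g = diag(d) u k` (★ + §1), the shared law (T)(N) = §2, then ON `K` §3 + ★ (β4-ii) + `|det k|_𝔸 = 1` + (K)
    intro i s g hs
    have hs' : 1 < (2 * s + 1).re := by rw [re_two_mul_add_one]; linarith
    obtain ⟨p, hp, k, hk, rfl⟩ := exists_borel_mul_standardMaximalCompactGL g
    obtain ⟨d, u, hu10, hu00, hu11, -, -, rfl⟩ := exists_glDiagonal_mul_of_mem_standardParabolicGL hp
    simp_rw [godementSection_glDiagonal_mul_mul ν _ (s + 1 / 2) d hu10 hu00 hu11 k]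
    rw [mul_assoc (glDiagonal 2 (AdeleRing (𝓞 L) L) d) u k, hT i s hs d (u * k), hN i s hs u k hu10 hu00 hu11,
      ideleNorm_det_eq_one_of_isCompact (isCompact_standardMaximalCompactGL 2 L) hk, NNReal.coe_one, Complex.ofReal_one, Complex.one_cpow,
      hK i s hs k hk, Finset.mul_sum]
    refine Finset.sum_congr rfl fun j _ => ?_
    have hgm : Measurable fun x : (mixedSpace L)ˣ => Φinf i j (fun l => (x : mixedSpace L) *
        ((GLn.toMixed 2 L k : GL (Fin 2) (mixedSpace L)) : Matrix (Fin 2) (Fin 2) (mixedSpace L)) 1 l) :=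
      ((Φinf i j).continuous.comp (continuous_pi fun l => Units.continuous_val.mul continuous_const)).measurable
    rw [tateVectorIntegral_tensor_eq ν (Φinf i j) (Φfin i j) S (βf i j) (hfin i j) (s + 1 / 2) (2 * s + 1) (by ring) hk,
      (hmain (2 * s + 1) hs' _ hgm (hgi i j (2 * s + 1) hs' k hk)).2, one_mul]
    exact cancel_aux hcM0 (hasProd_partialDedekindZeta (S := (↑S : Set (HeightOneSpectrum (𝓞 L)))) hs').2

end Main

end Summit.HodgeConjecture.HodgeConjecture.Cruxes.HLiu418.K2LiuGL2GodementSectionsExhaustGlobal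

end
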